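import Mathlib.RingTheory.LocalRing.Basic
import Literature.NumberTheory.GaloisCohomology.KatoCohomologyPurityDeRham
import HarnessLib

/-!
# Integral logarithmic forms over a local subring generate the integral forms
# (Bloch–Kato 1986, Lemma (4.2), surjectivity, for a local ring)

For a field (or commutative ring) `K`, a subring `T ⊆ K` which is a LOCAL ring, and `n ≥ 0`, the additive
subgroup of `Ωⁿ_K = ⋀ⁿ_K Ω[K⁄ℤ]` generated by the `T`-integral LOGARITHMIC forms
`a · dlog b₀ ∧ ⋯ ∧ dlog b_{n-1}` (`a ∈ T`, `bᵢ, bᵢ⁻¹ ∈ T`) coincides with the subgroup generated by the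
`T`-integral forms `t₀ · dt₁ ∧ ⋯ ∧ dtₙ` (`tᵢ ∈ T`), i.e. with the image of `Ωⁿ_T`
(`closure_integralLogForms_eq_closure_integralForms`).  Reason [cite: BlochKato1986, Lemma (4.2)]: a local
ring is additively generated by its units — for `t ∈ T` either `t` or `t − 1` is a unit `u` of `T`, and
`dt = du = u · dlog u`; conversely `a · dlog b = (a ∏ bᵢ⁻¹) · db₀ ∧ ⋯`.

Consequence for Kato's group through forms (`KatoCohomologyDeRham p K n`, file
`KatoCohomologyDifferentialForms`): the subgroup `integralFormClasses p n T` of the named fact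
`GrosSuwa1988_purity_deRham` (`KatoCohomologyPurityDeRham`) IS the image of the `T`-integral `n`-forms
(`integralFormClasses_eq_map_closure_integralForms`) — the form in which Gersten purity for
`H¹(−, Ωⁿ_log) = Ωⁿ/(dΩⁿ⁻¹ + (F − 1)Ωⁿ)` is printed (Gros–Suwa 1988; Shiho 2007, Prop. 2.8).  Everything is
proved; no named fact.

## References

* S. Bloch, K. Kato, *p-adic étale cohomology*, Publ. Math. IHÉS 63 (1986), Lemma (4.2), p. 122 ("Assume
  `R` is additively generated by `R^*` (e.g. `R` local). Then `δ` is surjective"). [BlochKato1986]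
-/

noncomputable section

open KaehlerDifferential (D)

namespace Literature.NumberTheory.GaloisCohomology

universe u

variable {K : Type u} [Field K]

/-- In a local subring `T ⊆ K`, every element has the same differential as a unit of `T`: `dt = du` with
`u = t` (if `t` is a unit) or `u = t - 1` (otherwise `1 - t` is a unit). [cite: BlochKato1986, Lemma (4.2)] -/
theorem exists_unit_D_eq_of_isLocalRing (T : Subring K) [IsLocalRing T] {t : K} (ht : t ∈ T) :
    ∃ u : Kˣ, (u : K) ∈ T ∧ (((u⁻¹ : Kˣ) : K) ∈ T) ∧ D ℤ K t = D ℤ K u := by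
  rcases IsLocalRing.isUnit_or_isUnit_one_sub_self (⟨t, ht⟩ : T) with ⟨v, hv⟩ | ⟨v, hv⟩
  · refine ⟨Units.map T.subtype.toMonoidHom v, (v : T).2, (v⁻¹ : Tˣ).1.2, ?_⟩
    simp only [Units.coe_map, RingHom.toMonoidHom_eq_coe, MonoidHom.coe_coe, Subring.subtype_apply, hv]
  · refine ⟨-Units.map T.subtype.toMonoidHom v, ?_, ?_, ?_⟩
    · simp only [Units.val_neg, Units.coe_map, RingHom.toMonoidHom_eq_coe, MonoidHom.coe_coe,
        Subring.subtype_apply]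
      exact T.neg_mem (v : T).2
    · rw [inv_neg, Units.val_neg]
      exact T.neg_mem (by simp only [Units.coe_map_inv, RingHom.toMonoidHom_eq_coe, MonoidHom.coe_coe,
        Subring.subtype_apply]; exact (v⁻¹ : Tˣ).1.2)
    · have hv' : ((Units.map T.subtype.toMonoidHom v : Kˣ) : K) = 1 - t := by
        simp only [Units.coe_map, RingHom.toMonoidHom_eq_coe, MonoidHom.coe_coe, Subring.subtype_apply, hv]
        rfl
      rw [Units.val_neg, hv', neg_sub, map_sub, Derivation.map_one_eq_zero, sub_zero]

variable (K)

/-- **Integral logarithmic forms generate the integral forms over a local subring** (Bloch–Kato,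
Lemma (4.2), surjectivity of `δ` for a local ring): for a local subring `T ⊆ K`, the subgroup of `Ωⁿ_K`
generated by the `a · dlog b₀ ∧ ⋯ ∧ dlog b_{n-1}` with `a, bᵢ, bᵢ⁻¹ ∈ T` equals the subgroup generated by the
`t₀ · dt₁ ∧ ⋯ ∧ dtₙ` with `tᵢ ∈ T`. [cite: BlochKato1986, Lemma (4.2), p. 122] -/
theorem closure_integralLogForms_eq_closure_integralForms (T : Subring K) [IsLocalRing T] (n : ℕ) :
    AddSubgroup.closure {ω : ⋀[K]^n (Ω[K⁄ℤ]) | ∃ (a : K) (b : Fin n → Kˣ), a ∈ T ∧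
        (∀ i, (b i : K) ∈ T ∧ (((b i)⁻¹ : Kˣ) : K) ∈ T) ∧ ω = a • dlogForm K b} =
      AddSubgroup.closure {ω : ⋀[K]^n (Ω[K⁄ℤ]) | ∃ (t : K) (s : Fin n → K), t ∈ T ∧ (∀ i, s i ∈ T) ∧
        ω = t • exteriorPower.ιMulti K n (fun i => D ℤ K (s i))} := by
  -- `dlogForm b = (∏ bᵢ⁻¹) • (db₀ ∧ ⋯)`
  have hdlog : ∀ b : Fin n → Kˣ, dlogForm K b =
      (∏ i, (((b i)⁻¹ : Kˣ) : K)) • exteriorPower.ιMulti K n (fun i => D ℤ K (b i)) := fun b => by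
    rw [dlogForm, ← AlternatingMap.map_smul_univ]
    rfl
  apply le_antisymm
  · rw [AddSubgroup.closure_le]
    rintro _ ⟨a, b, ha, hb, rfl⟩
    refine AddSubgroup.subset_closure ⟨a * ∏ i, (((b i)⁻¹ : Kˣ) : K), fun i => (b i : K), ?_, fun i => (hb i).1, ?_⟩
    · exact T.mul_mem ha (T.prod_mem fun i _ => (hb i).2)
    · rw [hdlog, smul_smul]
  · rw [AddSubgroup.closure_le]
    rintro _ ⟨t, s, ht, hs, rfl⟩
    choose u hu hu' hD using fun i => exists_unit_D_eq_of_isLocalRing T (hs i)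
    have hι : exteriorPower.ιMulti K n (fun i => D ℤ K (s i)) = (∏ i, (u i : K)) • dlogForm K u := by
      rw [hdlog, smul_smul, ← Finset.prod_mul_distrib]
      simp only [Units.mul_inv, Finset.prod_const_one, one_smul]
      exact congrArg _ (funext hD)
    refine AddSubgroup.subset_closure ⟨t * ∏ i, (u i : K), u, ?_, fun i => ⟨hu i, hu' i⟩, ?_⟩
    · exact T.mul_mem ht (T.prod_mem fun i _ => hu i)
    · rw [hι, smul_smul]

/-- **`integralFormClasses p n T` is the image of the `T`-integral `n`-forms** for a local subring `T ⊆ K`: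
the subgroup of `KatoCohomologyDeRham p K n` generated by the `T`-integral logarithmic form classes equals the
image of the subgroup of `Ωⁿ_K` generated by the `t₀ · dt₁ ∧ ⋯ ∧ dtₙ`, `tᵢ ∈ T` (the image of
`Ωⁿ_T → Ωⁿ_K → H^{n+1}_p(K)`). [cite: BlochKato1986, Lemma (4.2), p. 122] -/
theorem integralFormClasses_eq_map_closure_integralForms (p : ℕ) (T : Subring K) [IsLocalRing T] (n : ℕ) :
    integralFormClasses p n (T : Set K) =
      (AddSubgroup.closure {ω : ⋀[K]^n (Ω[K⁄ℤ]) | ∃ (t : K) (s : Fin n → K), t ∈ T ∧ (∀ i, s i ∈ T) ∧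
        ω = t • exteriorPower.ιMulti K n (fun i => D ℤ K (s i))}).map
        (QuotientAddGroup.mk' (exactForms K n ⊔ artinSchreierForms K p n)) := by
  rw [← closure_integralLogForms_eq_closure_integralForms K T n, AddMonoidHom.map_closure, integralFormClasses]
  congr 1
  ext x
  simp only [Set.mem_setOf_eq, Set.mem_image, SetLike.mem_coe]
  constructor
  · rintro ⟨a, b, ha, hb, rfl⟩
    exact ⟨a • dlogForm K b, ⟨a, b, ha, hb, rfl⟩, rfl⟩
  · rintro ⟨_, ⟨a, b, ha, hb, rfl⟩, rfl⟩
    exact ⟨a, b, ha, hb, rfl⟩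

end Literature.NumberTheory.GaloisCohomology

end
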